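import Literature.Analysis.SpecialFunctions.DigammaGauss
import Mathlib.Analysis.SpecialFunctions.ImproperIntegrals
import Mathlib.MeasureTheory.Integral.IntegralEqImproper
import Mathlib.MeasureTheory.Integral.DominatedConvergence
import HarnessLib

/-!
# The half-step comparison `Re ψ(1/2 + iy) ≤ Re ψ(1 + iy)` for the digamma function

Cell `rh-explicit`, venture WeilGRH / P-1 «A2-ext» (GL₂ window certificates; producer seat
rh-explicit-moll-step0-2): the analytic input of the GL₂ base-rung TRANSFER theorem
(`GL2BaseRungTransfer.lean`). For every real `y`:
* `digamma_one_add_sub_digamma_half_add_eq_integral`: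
  `ψ(1 + iy) − ψ(1/2 + iy) = ∫₀^∞ e^{−iyu} (e^{u/2} + 1)⁻¹ du` — from the series of
  Andrews–Askey–Roy Thm. 1.2.5 (1.2.13) (`hasSum_one_div_sub_one_div_digamma`) term by term
  (`1/(w+k) = ∫₀^∞ e^{−(w+k)u} du`, dominated convergence, `Σ_k (e^{−(k+1/2)u} − e^{−(k+1)u}) =
  (e^{u/2}+1)⁻¹`); the difference of two instances of Gauss's integral for `ψ`;
* `integral_cos_mul_inv_exp_half_add_one_nonneg`: `0 ≤ ∫₀^∞ cos(yu) (e^{u/2}+1)⁻¹ du`, since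
  `φ(u) = (e^{u/2}+1)⁻¹` is convex and decreasing with `φ, φ' → 0`: two integrations by parts give
  `∫₀^∞ cos(yu) φ = y⁻² ∫₀^∞ (1 − cos(yu)) φ'' ≥ 0` (`y ≠ 0`);
* `re_digamma_half_add_le_re_digamma_one_add`: **`Re ψ(1/2 + iy) ≤ Re ψ(1 + iy)`**;
  `re_digamma_one_add_le_re_digamma_nat_add`: `Re ψ(1 + iy) ≤ Re ψ(m + iy)`, `m ≥ 1`.
(`x ↦ Re ψ(x + iy)` is NOT monotone in general — `Re ψ(1/2 + iy) < Re ψ(1/4 + iy)` for `y ≈ 0.74`;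
with duplication and the tree's `re_digamma_quarter_le_three_quarters` the half step yields
`Re ψ(k/2 + it) ≥ Re ψ(1/4 + it/2) + log 2`, the GL₂-vs-`ζ` density comparison.)
Reference: G. E. Andrews, R. Askey, R. Roy, *Special Functions*, CUP 1999, Thm. 1.2.5 (1.2.13), §1.6.
-/
noncomputable section

open Complex Filter Topology Set MeasureTheory
open scoped Real

namespace Summit.Ventures.WeilGRH

open Literature.Analysis.SpecialFunctions.Complex

/-- `∫₀^∞ e^{−cu} du = 1/c` for `Re c > 0`. [folklore] -/
lemma integral_exp_neg_mul_Ioi {c : ℂ} (hc : 0 < c.re) :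
    ∫ u in Ioi (0 : ℝ), cexp (-c * u) = 1 / c := by
  have h := integral_exp_mul_complex_Ioi (a := -c) (by simpa using hc) 0
  simp only [ofReal_zero, mul_zero, Complex.exp_zero] at h
  rw [h]
  field_simp

/-- Factorisation of the `k`-th term: `e^{−(k+1/2+iy)u} − e^{−(k+1+iy)u} = e^{−iyu}(e^{−(k+1/2)u} − e^{−(k+1)u})`.
[folklore] -/
lemma exp_term_eq (y : ℝ) (k : ℕ) (u : ℝ) :
    cexp (-((k : ℂ) + 1 / 2 + y * I) * u) - cexp (-((k : ℂ) + 1 + y * I) * u) =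
      cexp (-(y * u) * I) *
        ((Real.exp (-((k : ℝ) + 1 / 2) * u) - Real.exp (-((k : ℝ) + 1) * u) : ℝ) : ℂ) := by
  have h1 : -((k : ℂ) + 1 / 2 + y * I) * u = (-(y * u) * I : ℂ) + ((-((k : ℝ) + 1 / 2) * u : ℝ) : ℂ) := by
    push_cast; ring
  have h2 : -((k : ℂ) + 1 + y * I) * u = (-(y * u) * I : ℂ) + ((-((k : ℝ) + 1) * u : ℝ) : ℂ) := by
    push_cast; ring
  rw [h1, h2, Complex.exp_add, Complex.exp_add, Complex.ofReal_sub, Complex.ofReal_exp,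
    Complex.ofReal_exp]
  ring

/-- The `k`-th term of the series is an integral:
`∫₀^∞ (e^{−(k+1/2+iy)u} − e^{−(k+1+iy)u}) du = 1/(k+1/2+iy) − 1/(k+1+iy)`. [folklore] -/
lemma integral_exp_term (y : ℝ) (k : ℕ) :
    ∫ u in Ioi (0 : ℝ), (cexp (-((k : ℂ) + 1 / 2 + y * I) * u) - cexp (-((k : ℂ) + 1 + y * I) * u)) =
      1 / ((k : ℂ) + 1 / 2 + y * I) - 1 / ((k : ℂ) + 1 + y * I) := by
  have ha : 0 < ((k : ℂ) + 1 / 2 + y * I).re := by simp; positivity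
  have hb : 0 < ((k : ℂ) + 1 + y * I).re := by simp; positivity
  have hia : IntegrableOn (fun u : ℝ ↦ cexp (-((k : ℂ) + 1 / 2 + y * I) * u)) (Ioi 0) :=
    integrableOn_exp_mul_complex_Ioi (by rw [neg_re]; exact neg_lt_zero.2 ha) 0
  have hib : IntegrableOn (fun u : ℝ ↦ cexp (-((k : ℂ) + 1 + y * I) * u)) (Ioi 0) :=
    integrableOn_exp_mul_complex_Ioi (by rw [neg_re]; exact neg_lt_zero.2 hb) 0
  rw [integral_sub hia hib, integral_exp_neg_mul_Ioi ha, integral_exp_neg_mul_Ioi hb]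

/-- For `u > 0`: `Σ_k (e^{−(k+1/2)u} − e^{−(k+1)u}) = (e^{u/2} + 1)⁻¹` (geometric series in `e^{−u}`,
`(w − w²)/(1 − w²) = w/(1 + w)` with `w = e^{−u/2}`). [folklore] -/
lemma hasSum_exp_term_real {u : ℝ} (hu : 0 < u) :
    HasSum (fun k : ℕ ↦ Real.exp (-((k : ℝ) + 1 / 2) * u) - Real.exp (-((k : ℝ) + 1) * u))
      (Real.exp (u / 2) + 1)⁻¹ := by
  set w : ℝ := Real.exp (-(u / 2)) with hw
  have hw0 : 0 < w := Real.exp_pos _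
  have hw1 : w < 1 := Real.exp_lt_one_iff.mpr (by linarith)
  have hr0 : 0 ≤ w ^ 2 := by positivity
  have hr1 : w ^ 2 < 1 := by nlinarith
  have hgeom := hasSum_geometric_of_lt_one hr0 hr1
  have hterm : ∀ k : ℕ, Real.exp (-((k : ℝ) + 1 / 2) * u) - Real.exp (-((k : ℝ) + 1) * u) =
      (w - w ^ 2) * (w ^ 2) ^ k := by
    intro k
    have e1 : Real.exp (-((k : ℝ) + 1 / 2) * u) = w * (w ^ 2) ^ k := by
      rw [hw, ← Real.exp_nat_mul, ← Real.exp_nat_mul, ← Real.exp_add]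
      congr 1; push_cast; ring
    have e2 : Real.exp (-((k : ℝ) + 1) * u) = w ^ 2 * (w ^ 2) ^ k := by
      rw [hw, ← Real.exp_nat_mul, ← Real.exp_nat_mul, ← Real.exp_add]
      congr 1; push_cast; ring
    rw [e1, e2]; ring
  have hval : (w - w ^ 2) * (1 - w ^ 2)⁻¹ = (Real.exp (u / 2) + 1)⁻¹ := by
    have he : Real.exp (u / 2) = w⁻¹ := by rw [hw, Real.exp_neg, inv_inv]
    have h1 : 1 - w ^ 2 ≠ 0 := by nlinarith
    have h2 : 1 + w ≠ 0 := by linarith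
    rw [he]; field_simp; ring
  rw [← hval]
  simpa only [hterm] using hgeom.mul_left (w - w ^ 2)

/-- **`ψ(1 + iy) − ψ(1/2 + iy) = ∫₀^∞ e^{−iyu} (e^{u/2}+1)⁻¹ du`** (difference of two Gauss
integrals; here from the series (1.2.13) by termwise integration and dominated convergence).
[cite: AndrewsAskeyRoy1999, Thm 1.2.5 (1.2.13)] -/
theorem digamma_one_add_sub_digamma_half_add_eq_integral (y : ℝ) :
    digamma (1 + y * I) - digamma (1 / 2 + y * I) =
      ∫ u in Ioi (0 : ℝ), cexp (-(y * u) * I) * ((Real.exp (u / 2) + 1)⁻¹ : ℝ) := by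
  -- the series side
  have h1 := hasSum_one_div_sub_one_div_digamma (w := 1 + y * I) (by simp)
  have h2 := hasSum_one_div_sub_one_div_digamma (w := 1 / 2 + y * I) (by simp)
  have hser : HasSum (fun k : ℕ ↦ 1 / ((k : ℂ) + 1 / 2 + y * I) - 1 / ((k : ℂ) + 1 + y * I))
      (digamma (1 + y * I) - digamma (1 / 2 + y * I)) := by
    have h := h2.sub h1
    have hv : digamma (1 / 2 + y * I) + Real.eulerMascheroniConstant -
        (digamma (1 + y * I) + Real.eulerMascheroniConstant) =
        -(digamma (1 + y * I) - digamma (1 / 2 + y * I)) := by ring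
    rw [hv] at h
    have h' := h.neg; rw [neg_neg] at h'
    refine h'.congr_fun fun k ↦ ?_
    have e1 : (1 : ℂ) + y * I + k = (k : ℂ) + 1 + y * I := by ring
    have e2 : (1 : ℂ) / 2 + y * I + k = (k : ℂ) + 1 / 2 + y * I := by ring
    rw [e1, e2]; ring
  -- the integral side: dominated convergence on `(0, ∞)`
  set μ : Measure ℝ := volume.restrict (Ioi (0 : ℝ)) with hμ
  set F : ℕ → ℝ → ℂ := fun k u ↦
    cexp (-((k : ℂ) + 1 / 2 + y * I) * u) - cexp (-((k : ℂ) + 1 + y * I) * u) with hF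
  set bound : ℕ → ℝ → ℝ := fun k u ↦
    Real.exp (-((k : ℝ) + 1 / 2) * u) - Real.exp (-((k : ℝ) + 1) * u) with hbound
  set f : ℝ → ℂ := fun u ↦ cexp (-(y * u) * I) * ((Real.exp (u / 2) + 1)⁻¹ : ℝ) with hf
  have hae : ∀ᵐ u ∂μ, u ∈ Ioi (0 : ℝ) := ae_restrict_mem measurableSet_Ioi
  have hF_meas : ∀ k, AEStronglyMeasurable (F k) μ := fun k ↦
    (by simp only [hF]; fun_prop : Continuous (F k)).aestronglyMeasurable
  have hbound_nonneg : ∀ k, ∀ u ∈ Ioi (0 : ℝ), 0 ≤ bound k u := by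
    intro k u hu
    simp only [hbound, sub_nonneg]
    exact Real.exp_le_exp.2 (by nlinarith [mem_Ioi.1 hu])
  have h_bound : ∀ k, ∀ᵐ u ∂μ, ‖F k u‖ ≤ bound k u := fun k ↦ hae.mono fun u hu ↦ by
    simp only [hF, hbound]
    rw [exp_term_eq, norm_mul, show (-(y * u) * I : ℂ) = ((-(y * u) : ℝ) : ℂ) * I by push_cast; ring,
      Complex.norm_exp_ofReal_mul_I, one_mul, Complex.norm_real, Real.norm_eq_abs,
      abs_of_nonneg (hbound_nonneg k u hu)]
  have h_sum : ∀ u ∈ Ioi (0 : ℝ), HasSum (fun k ↦ bound k u) (Real.exp (u / 2) + 1)⁻¹ :=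
    fun u hu ↦ hasSum_exp_term_real (mem_Ioi.1 hu)
  have bound_summable : ∀ᵐ u ∂μ, Summable fun k ↦ bound k u :=
    hae.mono fun u hu ↦ (h_sum u hu).summable
  have bound_integrable : Integrable (fun u ↦ ∑' k, bound k u) μ := by
    have hcont : Continuous fun u : ℝ ↦ (Real.exp (u / 2) + 1)⁻¹ := by
      refine Continuous.inv₀ (by fun_prop) fun u ↦ by positivity
    have hint : Integrable (fun u : ℝ ↦ (Real.exp (u / 2) + 1)⁻¹) μ := by
      refine Integrable.mono' (integrableOn_exp_mul_Ioi (by norm_num : -(1 / 2 : ℝ) < 0) 0)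
        hcont.aestronglyMeasurable (Eventually.of_forall fun u ↦ ?_)
      rw [Real.norm_eq_abs, abs_of_nonneg (by positivity),
        show Real.exp (-(1 / 2) * u) = (Real.exp (u / 2))⁻¹ by rw [← Real.exp_neg]; congr 1; ring]
      exact inv_anti₀ (Real.exp_pos _) (by linarith)
    refine hint.congr (hae.mono fun u hu ↦ ?_)
    exact ((h_sum u hu).tsum_eq).symm
  have h_lim : ∀ᵐ u ∂μ, HasSum (fun k ↦ F k u) (f u) := hae.mono fun u hu ↦ by
    have hc := (Complex.hasSum_ofReal.2 (h_sum u hu)).mul_left (cexp (-(y * u) * I))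
    refine hc.congr_fun fun k ↦ ?_
    simp only [hF]
    rw [exp_term_eq]
  have hdct := hasSum_integral_of_dominated_convergence bound hF_meas h_bound bound_summable
    bound_integrable h_lim
  -- identify the terms and conclude by uniqueness of sums
  have hterms : (fun k ↦ ∫ u, F k u ∂μ) =
      fun k : ℕ ↦ 1 / ((k : ℂ) + 1 / 2 + y * I) - 1 / ((k : ℂ) + 1 + y * I) := by
    funext k
    exact integral_exp_term y k
  rw [hterms] at hdct
  exact hser.unique hdct

/-- First derivative of `φ(u) = (e^{u/2}+1)⁻¹`: `φ'(u) = −e^{u/2} / (2 (e^{u/2}+1)²)`. [folklore] -/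
lemma hasDerivAt_inv_exp_half_add_one (u : ℝ) :
    HasDerivAt (fun u : ℝ ↦ (Real.exp (u / 2) + 1)⁻¹)
      (-(Real.exp (u / 2)) / (2 * (Real.exp (u / 2) + 1) ^ 2)) u := by
  have h1 : HasDerivAt (fun u : ℝ ↦ Real.exp (u / 2) + 1) (Real.exp (u / 2) * (1 / 2)) u :=
    (((hasDerivAt_id' u).div_const 2).exp).add_const 1
  have h2 : HasDerivAt (fun u : ℝ ↦ (Real.exp (u / 2) + 1)⁻¹)
      (-(Real.exp (u / 2) * (1 / 2)) / (Real.exp (u / 2) + 1) ^ 2) u := h1.inv (by positivity)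
  convert h2 using 1
  have hp : Real.exp (u / 2) + 1 ≠ 0 := by positivity
  field_simp

/-- Second derivative: `φ''(u) = e^{u/2}(e^{u/2} − 1) / (4 (e^{u/2}+1)³)`. [folklore] -/
lemma hasDerivAt_deriv_inv_exp_half_add_one (u : ℝ) :
    HasDerivAt (fun u : ℝ ↦ -(Real.exp (u / 2)) / (2 * (Real.exp (u / 2) + 1) ^ 2))
      (Real.exp (u / 2) * (Real.exp (u / 2) - 1) / (4 * (Real.exp (u / 2) + 1) ^ 3)) u := by
  have he : HasDerivAt (fun u : ℝ ↦ Real.exp (u / 2)) (Real.exp (u / 2) * (1 / 2)) u :=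
    ((hasDerivAt_id' u).div_const 2).exp
  have hnum : HasDerivAt (fun u : ℝ ↦ -(Real.exp (u / 2))) (-(Real.exp (u / 2) * (1 / 2))) u :=
    he.neg
  have hden' : HasDerivAt (fun u : ℝ ↦ 2 * ((Real.exp (u / 2) + 1) * (Real.exp (u / 2) + 1)))
      (2 * (Real.exp (u / 2) * (1 / 2) * (Real.exp (u / 2) + 1) +
        (Real.exp (u / 2) + 1) * (Real.exp (u / 2) * (1 / 2)))) u :=
    ((he.add_const 1).mul (he.add_const 1)).const_mul 2
  have hfeq : (fun u : ℝ ↦ 2 * (Real.exp (u / 2) + 1) ^ 2) =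
      fun u : ℝ ↦ 2 * ((Real.exp (u / 2) + 1) * (Real.exp (u / 2) + 1)) := by
    funext v; ring
  have hden : HasDerivAt (fun u : ℝ ↦ 2 * (Real.exp (u / 2) + 1) ^ 2)
      (2 * (Real.exp (u / 2) * (1 / 2) * (Real.exp (u / 2) + 1) +
        (Real.exp (u / 2) + 1) * (Real.exp (u / 2) * (1 / 2)))) u := by
    rw [hfeq]; exact hden'
  have h : HasDerivAt (fun u : ℝ ↦ -(Real.exp (u / 2)) / (2 * (Real.exp (u / 2) + 1) ^ 2))
      ((-(Real.exp (u / 2) * (1 / 2)) * (2 * (Real.exp (u / 2) + 1) ^ 2) -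
        -Real.exp (u / 2) * (2 * (Real.exp (u / 2) * (1 / 2) * (Real.exp (u / 2) + 1) +
          (Real.exp (u / 2) + 1) * (Real.exp (u / 2) * (1 / 2))))) /
        (2 * (Real.exp (u / 2) + 1) ^ 2) ^ 2) u := hnum.div hden (by positivity)
  refine h.congr_deriv ?_
  have hp : Real.exp (u / 2) + 1 ≠ 0 := by positivity
  field_simp
  ring

/-- **`0 ≤ ∫₀^∞ cos(yu) (e^{u/2}+1)⁻¹ du`** for every real `y`: for `y ≠ 0` two integrations by
parts on `(0, ∞)` give `∫₀^∞ cos(yu) φ(u) du = y⁻² ∫₀^∞ (1 − cos(yu)) φ''(u) du` with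
`φ'' ≥ 0` (`φ(u) = (e^{u/2}+1)⁻¹` is convex and decreasing, `φ(0)·0 = φ'(0)·(1 − cos 0) = 0`,
`φ, φ' → 0`). [folklore] -/
theorem integral_cos_mul_inv_exp_half_add_one_nonneg (y : ℝ) :
    0 ≤ ∫ u in Ioi (0 : ℝ), Real.cos (y * u) * (Real.exp (u / 2) + 1)⁻¹ := by
  -- notation
  set φ : ℝ → ℝ := fun u ↦ (Real.exp (u / 2) + 1)⁻¹ with hφ
  set φ₁ : ℝ → ℝ := fun u ↦ -(Real.exp (u / 2)) / (2 * (Real.exp (u / 2) + 1) ^ 2) with hφ₁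
  set φ₂ : ℝ → ℝ := fun u ↦
    Real.exp (u / 2) * (Real.exp (u / 2) - 1) / (4 * (Real.exp (u / 2) + 1) ^ 3) with hφ₂
  have hdφ : ∀ u, HasDerivAt φ (φ₁ u) u := hasDerivAt_inv_exp_half_add_one
  have hdφ₁ : ∀ u, HasDerivAt φ₁ (φ₂ u) u := hasDerivAt_deriv_inv_exp_half_add_one
  have hφc : Continuous φ := Continuous.inv₀ (by fun_prop) fun u ↦ by positivity
  have hφ₁c : Continuous φ₁ := Continuous.div (by fun_prop) (by fun_prop) fun u ↦ by positivity
  have hφ₂c : Continuous φ₂ := Continuous.div (by fun_prop) (by fun_prop) fun u ↦ by positivity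
  -- exponential majorants on `u ≥ 0`
  have hE : ∀ u : ℝ, Real.exp (-(1 / 2) * u) = (Real.exp (u / 2))⁻¹ := fun u ↦ by
    rw [← Real.exp_neg]; congr 1; ring
  have hφ_le : ∀ u : ℝ, |φ u| ≤ Real.exp (-(1 / 2) * u) := fun u ↦ by
    rw [hE, hφ, abs_of_nonneg (by positivity)]
    exact inv_anti₀ (Real.exp_pos _) (by linarith)
  have hφ₁_le : ∀ u : ℝ, |φ₁ u| ≤ Real.exp (-(1 / 2) * u) := fun u ↦ by
    have he0 : 0 < Real.exp (u / 2) := Real.exp_pos _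
    rw [hE, hφ₁, abs_div, abs_neg, abs_of_pos he0, abs_of_pos (by positivity),
      div_le_iff₀ (by positivity), inv_mul_eq_div, le_div_iff₀ he0]
    nlinarith
  have hφ₂_le : ∀ u : ℝ, 0 ≤ u → |φ₂ u| ≤ Real.exp (-(1 / 2) * u) := fun u hu ↦ by
    have he0 : 0 < Real.exp (u / 2) := Real.exp_pos _
    have he1 : 1 ≤ Real.exp (u / 2) := Real.one_le_exp (by linarith)
    rw [hE, hφ₂, abs_div, abs_of_pos (by positivity : (0 : ℝ) < 4 * (Real.exp (u / 2) + 1) ^ 3),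
      abs_of_nonneg (by nlinarith), div_le_iff₀ (by positivity), inv_mul_eq_div, le_div_iff₀ he0]
    nlinarith [pow_le_pow_left₀ he0.le (by linarith : Real.exp (u / 2) ≤ Real.exp (u / 2) + 1) 3]
  have hφ₂_nonneg : ∀ u : ℝ, 0 ≤ u → 0 ≤ φ₂ u := fun u hu ↦ by
    have he1 : 1 ≤ Real.exp (u / 2) := Real.one_le_exp (by linarith)
    exact div_nonneg (mul_nonneg (Real.exp_pos _).le (by linarith)) (by positivity)
  -- the case `y = 0`
  rcases eq_or_ne y 0 with hy | hy
  · subst hy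
    exact setIntegral_nonneg measurableSet_Ioi fun u _ ↦ by simp only [zero_mul, Real.cos_zero, one_mul]; positivity
  -- integrability of the four products on `(0, ∞)`
  have hexp : IntegrableOn (fun u : ℝ ↦ Real.exp (-(1 / 2) * u)) (Ioi 0) :=
    integrableOn_exp_mul_Ioi (by norm_num) 0
  have hdom : ∀ {h : ℝ → ℝ} {b : ℝ → ℝ} (C : ℝ), Continuous h → Continuous b →
      (∀ u : ℝ, 0 < u → |h u| ≤ Real.exp (-(1 / 2) * u)) → (∀ u, |b u| ≤ C) →
      IntegrableOn (fun u ↦ h u * b u) (Ioi 0) := by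
    intro h b C hh hb hh' hb'
    have hC : 0 ≤ C := (abs_nonneg _).trans (hb' 0)
    refine Integrable.mono' (hexp.mul_const C) ((hh.mul hb).aestronglyMeasurable)
      ((ae_restrict_mem measurableSet_Ioi).mono fun u hu ↦ ?_)
    rw [Real.norm_eq_abs, abs_mul]
    exact mul_le_mul (hh' u hu) (hb' u) (abs_nonneg _) (Real.exp_pos _).le
  have hb_cos : ∀ u : ℝ, |Real.cos (y * u)| ≤ 1 := fun u ↦ Real.abs_cos_le_one _
  have hb_sin : ∀ u : ℝ, |Real.sin (y * u) / y| ≤ |y|⁻¹ := fun u ↦ by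
    rw [abs_div, div_eq_mul_inv]
    exact mul_le_of_le_one_left (by positivity) (Real.abs_sin_le_one _)
  have hb_1cos : ∀ u : ℝ, |(1 - Real.cos (y * u)) / y| ≤ 2 * |y|⁻¹ := fun u ↦ by
    rw [abs_div, div_eq_mul_inv]
    refine mul_le_mul_of_nonneg_right ?_ (by positivity)
    have := Real.abs_cos_le_one (y * u)
    rw [abs_le] at this ⊢; constructor <;> linarith [this.1, this.2]
  have hI1 : IntegrableOn (fun u ↦ φ u * Real.cos (y * u)) (Ioi 0) :=
    hdom 1 hφc (by fun_prop) (fun u _ ↦ hφ_le u) hb_cos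
  have hI2 : IntegrableOn (fun u ↦ φ₁ u * (Real.sin (y * u) / y)) (Ioi 0) :=
    hdom _ hφ₁c (by fun_prop) (fun u _ ↦ hφ₁_le u) hb_sin
  have hI3 : IntegrableOn (fun u ↦ φ₁ u * Real.sin (y * u)) (Ioi 0) :=
    hdom 1 hφ₁c (by fun_prop) (fun u _ ↦ hφ₁_le u) fun u ↦ Real.abs_sin_le_one _
  have hI4 : IntegrableOn (fun u ↦ φ₂ u * ((1 - Real.cos (y * u)) / y)) (Ioi 0) :=
    hdom _ hφ₂c (by fun_prop) (fun u hu ↦ hφ₂_le u hu.le) hb_1cos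
  -- derivatives of the trigonometric factors
  have hdsin : ∀ u : ℝ, HasDerivAt (fun u : ℝ ↦ Real.sin (y * u) / y) (Real.cos (y * u)) u := by
    intro u
    have h : HasDerivAt (fun u : ℝ ↦ Real.sin (y * u) / y) (Real.cos (y * u) * (y * 1) / y) u :=
      (((hasDerivAt_id' u).const_mul y).sin).div_const y
    convert h using 1; field_simp
  have hd1cos : ∀ u : ℝ, HasDerivAt (fun u : ℝ ↦ (1 - Real.cos (y * u)) / y) (Real.sin (y * u)) u := by
    intro u
    have h : HasDerivAt (fun u : ℝ ↦ (1 - Real.cos (y * u)) / y)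
        (-(-Real.sin (y * u) * (y * 1)) / y) u :=
      ((((hasDerivAt_id' u).const_mul y).cos).const_sub 1).div_const y
    convert h using 1; field_simp
  -- limits at `0⁺` and at `∞`
  have hlim0 : ∀ {h b : ℝ → ℝ}, Continuous h → Continuous b → b 0 = 0 →
      Tendsto (h * b) (𝓝[>] (0 : ℝ)) (𝓝 0) := by
    intro h b hh hb hb0
    have : Tendsto (h * b) (𝓝 (0 : ℝ)) (𝓝 ((h * b) 0)) := (hh.mul hb).tendsto 0
    rw [Pi.mul_apply, hb0, mul_zero] at this
    exact this.mono_left nhdsWithin_le_nhds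
  have hexp0 : Tendsto (fun u : ℝ ↦ Real.exp (-(1 / 2) * u)) atTop (𝓝 0) := by
    have h := Real.tendsto_exp_neg_atTop_nhds_zero.comp
      (tendsto_id.const_mul_atTop (by norm_num : (0 : ℝ) < 1 / 2))
    exact h.congr fun u ↦ by simp only [Function.comp_apply, id_eq]; congr 1; ring
  have hlim_inf : ∀ {h b : ℝ → ℝ} (C : ℝ), (∀ u : ℝ, 0 < u → |h u| ≤ Real.exp (-(1 / 2) * u)) →
      (∀ u, |b u| ≤ C) → Tendsto (h * b) atTop (𝓝 0) := by
    intro h b C hh' hb'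
    have hC : 0 ≤ C := (abs_nonneg _).trans (hb' 0)
    have hl := hexp0.mul_const C; rw [zero_mul] at hl
    refine squeeze_zero_norm' ?_ hl
    filter_upwards [eventually_gt_atTop (0 : ℝ)] with u hu
    rw [Pi.mul_apply, Real.norm_eq_abs, abs_mul]
    exact mul_le_mul (hh' u hu) (hb' u) (abs_nonneg _) (Real.exp_pos _).le
  -- first integration by parts: `∫ φ cos(yu) = −∫ φ' sin(yu)/y`
  have hparts1 := integral_Ioi_mul_deriv_eq_deriv_mul (a := 0) (u := φ) (u' := φ₁)
    (v := fun u ↦ Real.sin (y * u) / y) (v' := fun u ↦ Real.cos (y * u))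
    (fun u _ ↦ hdφ u) (fun u _ ↦ hdsin u) hI1 hI2
    (hlim0 hφc (by fun_prop) (by simp))
    (hlim_inf _ (fun u _ ↦ hφ_le u) hb_sin)
  -- second integration by parts: `∫ φ' sin(yu) = −∫ φ'' (1 − cos(yu))/y`
  have hparts2 := integral_Ioi_mul_deriv_eq_deriv_mul (a := 0) (u := φ₁) (u' := φ₂)
    (v := fun u ↦ (1 - Real.cos (y * u)) / y) (v' := fun u ↦ Real.sin (y * u))
    (fun u _ ↦ hdφ₁ u) (fun u _ ↦ hd1cos u) hI3 hI4
    (hlim0 hφ₁c (by fun_prop) (by simp))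
    (hlim_inf _ (fun u _ ↦ hφ₁_le u) hb_1cos)
  -- assemble
  have hkey : ∫ u in Ioi (0 : ℝ), Real.cos (y * u) * φ u =
      (y ^ 2)⁻¹ * ∫ u in Ioi (0 : ℝ), φ₂ u * (1 - Real.cos (y * u)) := by
    have e1 : ∫ u in Ioi (0 : ℝ), Real.cos (y * u) * φ u = ∫ u in Ioi (0 : ℝ), φ u * Real.cos (y * u) := by
      congr 1 with u; ring
    have e2 : ∫ u in Ioi (0 : ℝ), φ₁ u * (Real.sin (y * u) / y) =
        y⁻¹ * ∫ u in Ioi (0 : ℝ), φ₁ u * Real.sin (y * u) := by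
      rw [← integral_const_mul]; congr 1 with u; rw [div_eq_mul_inv]; ring
    have e3 : ∫ u in Ioi (0 : ℝ), φ₂ u * ((1 - Real.cos (y * u)) / y) =
        y⁻¹ * ∫ u in Ioi (0 : ℝ), φ₂ u * (1 - Real.cos (y * u)) := by
      rw [← integral_const_mul]; congr 1 with u; rw [div_eq_mul_inv]; ring
    rw [e1, hparts1, sub_zero, zero_sub, e2, hparts2, sub_zero, zero_sub, e3]
    ring
  rw [hkey]
  refine mul_nonneg (by positivity) (setIntegral_nonneg measurableSet_Ioi fun u hu ↦ ?_)
  exact mul_nonneg (hφ₂_nonneg u (le_of_lt hu)) (by linarith [Real.cos_le_one (y * u)])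

/-- The real part of the integral representation:
`Re(ψ(1 + iy) − ψ(1/2 + iy)) = ∫₀^∞ cos(yu) (e^{u/2}+1)⁻¹ du`. [folklore] -/
theorem re_digamma_one_add_sub_digamma_half_add (y : ℝ) :
    (digamma (1 + y * I) - digamma (1 / 2 + y * I)).re =
      ∫ u in Ioi (0 : ℝ), Real.cos (y * u) * (Real.exp (u / 2) + 1)⁻¹ := by
  rw [digamma_one_add_sub_digamma_half_add_eq_integral]
  have hint : Integrable (fun u : ℝ ↦ cexp (-(y * u) * I) * ((Real.exp (u / 2) + 1)⁻¹ : ℝ))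
      (volume.restrict (Ioi (0 : ℝ))) := by
    have hdom : IntegrableOn (fun u : ℝ ↦ Real.exp (-(1 / 2) * u)) (Ioi 0) :=
      integrableOn_exp_mul_Ioi (by norm_num) 0
    refine Integrable.mono' hdom (Continuous.aestronglyMeasurable ?_) (Eventually.of_forall fun u ↦ ?_)
    · exact (by fun_prop : Continuous fun u : ℝ ↦ cexp (-(y * u) * I)).mul
        (continuous_ofReal.comp (Continuous.inv₀ (by fun_prop) fun u ↦ by positivity))
    · rw [norm_mul, show (-(y * u) * I : ℂ) = ((-(y * u) : ℝ) : ℂ) * I by push_cast; ring,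
        Complex.norm_exp_ofReal_mul_I, one_mul, Complex.norm_real, Real.norm_eq_abs,
        abs_of_nonneg (by positivity), show Real.exp (-(1 / 2) * u) = (Real.exp (u / 2))⁻¹ by
          rw [← Real.exp_neg]; congr 1; ring]
      exact inv_anti₀ (Real.exp_pos _) (by linarith)
  have h := integral_re hint
  simp only [RCLike.re_to_complex] at h
  rw [← h]; congr 1 with u
  rw [show (-(y * u) * I : ℂ) = ((-(y * u) : ℝ) : ℂ) * I by push_cast; ring, Complex.re_mul_ofReal,
    Complex.exp_ofReal_mul_I_re, Real.cos_neg]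

/-- **Half-step comparison**: `Re ψ(1/2 + iy) ≤ Re ψ(1 + iy)` for every real `y`
(`= ∫₀^∞ cos(yu)(e^{u/2}+1)⁻¹ du ≥ 0`; note that `x ↦ Re ψ(x + iy)` is not monotone in general).
[folklore] -/
theorem re_digamma_half_add_le_re_digamma_one_add (y : ℝ) :
    (digamma (1 / 2 + y * I)).re ≤ (digamma (1 + y * I)).re := by
  have h := integral_cos_mul_inv_exp_half_add_one_nonneg y
  rw [← re_digamma_one_add_sub_digamma_half_add, sub_re] at h
  linarith

/-- **Integer steps**: `Re ψ(1 + iy) ≤ Re ψ(m + iy)` for every integer `m ≥ 1`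
(`ψ(z + 1) = ψ(z) + 1/z` and `Re(1/(j + iy)) = j/(j² + y²) ≥ 0`). [folklore] -/
theorem re_digamma_one_add_le_re_digamma_nat_add (y : ℝ) {m : ℕ} (hm : 1 ≤ m) :
    (digamma (1 + y * I)).re ≤ (digamma ((m : ℂ) + y * I)).re := by
  induction m, hm using Nat.le_induction with
  | base => simp
  | succ m hm ih =>
    have hne : ∀ n : ℕ, (m : ℂ) + y * I ≠ -n := fun n h ↦ by
      have := congrArg Complex.re h; simp at this
      have h2 : (m + n : ℕ) = 0 := by exact_mod_cast (by linarith : (m : ℝ) + n = 0)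
      omega
    have hstep : digamma ((m : ℂ) + y * I + 1) = digamma ((m : ℂ) + y * I) + ((m : ℂ) + y * I)⁻¹ :=
      Complex.digamma_apply_add_one _ hne
    have hcast : ((m + 1 : ℕ) : ℂ) + y * I = (m : ℂ) + y * I + 1 := by push_cast; ring
    rw [hcast, hstep, add_re]
    have hre : 0 ≤ (((m : ℂ) + y * I)⁻¹).re := by
      rw [Complex.inv_re]; exact div_nonneg (by simp) (Complex.normSq_nonneg _)
    linarith

end Summit.Ventures.WeilGRH

end
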